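import Summits.Ventures.HodgeRepro2.T5HeckeDegreeIndex
import Summits.Ventures.HodgeRepro2.T5CartanTransposeGelfand

/-!
# The counting form of unimodularity from Gelfand's trick: `#(Kg⁻¹K/K) = #(KgK/K)`

Tier-5 kernel support (blind cell pub-hodge-repro2, seat p8, gen 11). Several Hecke files of
this seat (T5-69 `T5HeckeAdjoint`, T5-73, T5-77 `T5HeckeAdjointHermitian`, T5-95) carry the
hypothesis `hU : ∀ g, #(Kg⁻¹K/K) = #(KgK/K)` — the counting form of the unimodularity of `G`
(T5-98: `⟺ [gKg⁻¹ : K ∩ gKg⁻¹] = [K : K ∩ gKg⁻¹]`), «that a reductive `p`-adic group is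
unimodular» staying prose. This file derives `hU` from the hypotheses of Gelfand's trick in its
anti-automorphism form (T5-84: `τ : G ≃* Gᵐᵒᵖ`, `τ(K) = K`, `τ(x) ∈ K x K`), hence for
`GL_n(F) ⊃ GL_n(R)` from the transpose (T5-101):

`[gKg⁻¹ : K ∩ gKg⁻¹] = [K : K ∩ g⁻¹Kg]` (conjugation by `g⁻¹`) and `[K : K ∩ gKg⁻¹] =
[K : K ∩ σ(g)Kσ(g)⁻¹]` for the automorphism `σ = inv ∘ τ` (`σ(K) = K`), where
`σ(g) ∈ K g⁻¹ K`, so that `σ(g) K σ(g)⁻¹` is a `K`-conjugate of `g⁻¹ K g`.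

* `conjK_mul`, `conjK_eq_of_mem`, `relIndex_conjK_of_mem`, `map_conjK`, `map_eq_self_of_mem_iff`;
* `relIndex_conjK_eq_of_antiAut` — **`[gKg⁻¹ : K ∩ gKg⁻¹] = [K : K ∩ gKg⁻¹]`** under T5-84's
  hypotheses;
* `ncard_orbit_inv_eq_of_antiAut` — **`#(Kg⁻¹K/K) = #(KgK/K)`** (the `hU` of T5-69 / T5-77);
* `ncard_orbit_inv_eq_GL` — the same for `GL ι F`, `K = GL_n(R)`, `R` a PID with fraction
  field `F` (no finiteness needed; `ncard` of an infinite set is `0` on both sides).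

Hypotheses as stated in the kernel: a group `G`, a subgroup `K`, an anti-automorphism `τ` with
`hτK : ∀ x, unop (τ x) ∈ K ↔ x ∈ K` and `hτ : ∀ x, ↑(unop (τ x)) ∈ MulAction.orbit K ↑x`; for
`GL_n`: `R` a domain with `IsPrincipalIdealRing R`, `F` with `IsFractionRing R F`, `ι` finite.
-/

namespace Summit.Ventures.HodgeRepro2.T5GelfandUnimodular

open MulOpposite T5HeckeDegreeIndex

variable {G : Type*} [Group G] {K : Subgroup G}

/-- `(ab) K (ab)⁻¹ = a (b K b⁻¹) a⁻¹`. -/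
theorem conjK_mul (K : Subgroup G) (a b : G) : conjK K (a * b) = conjK (conjK K b) a := by
  ext x
  rw [mem_conjK_iff, mem_conjK_iff, mem_conjK_iff, mul_inv_rev]
  simp only [mul_assoc]

/-- `κ K κ⁻¹ = K` for `κ ∈ K`. -/
theorem conjK_eq_of_mem {κ : G} (hκ : κ ∈ K) : conjK K κ = K :=
  conjK_eq_of_mem_normalizer K (Subgroup.le_normalizer hκ)

/-- Conjugating the first argument of `relIndex` by an element of `K` changes nothing. -/
theorem relIndex_conjK_of_mem (S : Subgroup G) {κ : G} (hκ : κ ∈ K) :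
    (conjK S κ).relIndex K = S.relIndex K := by
  have h := Subgroup.relIndex_map_map_of_injective (f := (MulAut.conj κ).toMonoidHom) S K
    (MulAut.conj κ).injective
  have hK : Subgroup.map (MulAut.conj κ).toMonoidHom K = K := conjK_eq_of_mem hκ
  rw [hK] at h
  exact h

/-- An automorphism `σ` carries `h K h⁻¹` to `σ(h) σ(K) σ(h)⁻¹`. -/
theorem map_conjK (σ : G ≃* G) (K : Subgroup G) (h : G) :
    Subgroup.map σ.toMonoidHom (conjK K h) = conjK (Subgroup.map σ.toMonoidHom K) (σ h) := by
  ext x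
  rw [Subgroup.mem_map_equiv, mem_conjK_iff, mem_conjK_iff, Subgroup.mem_map_equiv, map_mul,
    map_mul, map_inv, σ.symm_apply_apply]

/-- `σ(K) = K` when `σ x ∈ K ↔ x ∈ K` for all `x`. -/
theorem map_eq_self_of_mem_iff (σ : G ≃* G) (hσ : ∀ x, σ x ∈ K ↔ x ∈ K) :
    Subgroup.map σ.toMonoidHom K = K := by
  ext x
  rw [Subgroup.mem_map_equiv, ← hσ, σ.apply_symm_apply]

/-- **The index identity of unimodularity from Gelfand's trick**: under T5-84's hypotheses on
`τ`, `[gKg⁻¹ : K ∩ gKg⁻¹] = [K : K ∩ gKg⁻¹]` for every `g`. -/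
theorem relIndex_conjK_eq_of_antiAut (τ : G ≃* Gᵐᵒᵖ) (hτK : ∀ x, unop (τ x) ∈ K ↔ x ∈ K)
    (hτ : ∀ x : G, (↑(unop (τ x)) : G ⧸ K) ∈ MulAction.orbit K (↑x : G ⧸ K)) (g : G) :
    K.relIndex (conjK K g) = (conjK K g).relIndex K := by
  set σ : G ≃* G := T5HeckeGelfandTrickGeneral.autOfAntiAut τ with hσdef
  have hσK : ∀ x, σ x ∈ K ↔ x ∈ K := T5HeckeGelfandTrickGeneral.autOfAntiAut_mem_iff τ hτK
  have hmapK : Subgroup.map σ.toMonoidHom K = K := map_eq_self_of_mem_iff σ hσK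
  -- Step A: conjugation by `g⁻¹` turns `[gKg⁻¹ : K ∩ gKg⁻¹]` into `[K : K ∩ g⁻¹Kg]`
  have hA : K.relIndex (conjK K g) = (conjK K g⁻¹).relIndex K := by
    have h := Subgroup.relIndex_map_map_of_injective (f := (MulAut.conj g⁻¹).toMonoidHom)
      K (conjK K g) (MulAut.conj g⁻¹).injective
    have h1 : Subgroup.map (MulAut.conj g⁻¹).toMonoidHom K = conjK K g⁻¹ := rfl
    have h2 : Subgroup.map (MulAut.conj g⁻¹).toMonoidHom (conjK K g) = K := by
      change conjK (conjK K g) g⁻¹ = K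
      rw [← conjK_mul, inv_mul_cancel]
      ext x
      rw [mem_conjK_iff, inv_one, one_mul, mul_one]
    rw [h1, h2] at h
    exact h.symm
  -- Step B: `σ` turns `[K : K ∩ gKg⁻¹]` into `[K : K ∩ σ(g)Kσ(g)⁻¹]`
  have hB : (conjK K g).relIndex K = (conjK K (σ g)).relIndex K := by
    have h := Subgroup.relIndex_map_map_of_injective (f := σ.toMonoidHom) (conjK K g) K
      σ.injective
    rw [map_conjK, hmapK] at h
    exact h.symm
  -- Step C: `σ(g) ∈ K g⁻¹ K`, so `σ(g) K σ(g)⁻¹` is a `K`-conjugate of `g⁻¹ K g`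
  have hC : (conjK K (σ g)).relIndex K = (conjK K g⁻¹).relIndex K := by
    obtain ⟨κ, hκ⟩ := MulAction.mem_orbit_iff.mp
      (T5HeckeGelfandTrickGeneral.inv_mem_orbit_autOfAntiAut τ hτ g)
    change ((↑κ * σ g : G) : G ⧸ K) = ↑g⁻¹ at hκ
    rw [QuotientGroup.eq] at hκ
    -- `g⁻¹ = κ σ(g) κ'` with `κ' := (κ σ(g))⁻¹ g⁻¹ ∈ K`, so `σ(g) = κ⁻¹ g⁻¹ κ'⁻¹`
    set κ' : G := (↑κ * σ g)⁻¹ * g⁻¹ with hκ'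
    have hσg : σ g = (↑κ)⁻¹ * g⁻¹ * κ'⁻¹ := by
      rw [hκ']
      group
    rw [hσg, conjK_mul, conjK_mul, conjK_eq_of_mem (Subgroup.inv_mem _ hκ),
      relIndex_conjK_of_mem _ (Subgroup.inv_mem _ κ.2)]
  rw [hA, ← hC, ← hB]

/-- **The counting form of unimodularity from Gelfand's trick**: `#(Kg⁻¹K/K) = #(KgK/K)` for
every `g` — the hypothesis `hU` of T5-69 / T5-73 / T5-77 / T5-95 — under T5-84's hypotheses. -/
theorem ncard_orbit_inv_eq_of_antiAut (τ : G ≃* Gᵐᵒᵖ) (hτK : ∀ x, unop (τ x) ∈ K ↔ x ∈ K)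
    (hτ : ∀ x : G, (↑(unop (τ x)) : G ⧸ K) ∈ MulAction.orbit K (↑x : G ⧸ K)) (g : G) :
    (MulAction.orbit K (↑g⁻¹ : G ⧸ K)).ncard = (MulAction.orbit K (↑g : G ⧸ K)).ncard := by
  rw [ncard_orbit_inv_eq_relIndex, ncard_orbit_eq_relIndex, relIndex_conjK_eq_of_antiAut τ hτK hτ]

section GeneralLinear

variable {R : Type*} [CommRing R] [IsDomain R] [IsPrincipalIdealRing R]
variable {F : Type*} [Field F] [Algebra R F] [IsFractionRing R F]
variable {ι : Type*} [Fintype ι] [DecidableEq ι]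

/-- **`GL_n(F)` is unimodular in the counting form**: `#(Kg⁻¹K/K) = #(KgK/K)` for
`K = GL_n(R)`, `R` a PID with fraction field `F` — the transpose supplies Gelfand's trick. -/
theorem ncard_orbit_inv_eq_GL (g : GL ι F) :
    (MulAction.orbit (Matrix.GeneralLinearGroup.map (n := ι) (algebraMap R F)).range
      (↑g⁻¹ : GL ι F ⧸ (Matrix.GeneralLinearGroup.map (n := ι) (algebraMap R F)).range)).ncard =
    (MulAction.orbit (Matrix.GeneralLinearGroup.map (n := ι) (algebraMap R F)).range
      (↑g : GL ι F ⧸ (Matrix.GeneralLinearGroup.map (n := ι) (algebraMap R F)).range)).ncard :=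
  ncard_orbit_inv_eq_of_antiAut T5CartanTransposeGelfand.transposeAntiAut
    (fun x => T5CartanTransposeGelfand.unop_transposeAntiAut_mem_iff (R := R) x)
    (fun x => T5CartanTransposeGelfand.unop_transposeAntiAut_mem_orbit (R := R) x) g

end GeneralLinear

end Summit.Ventures.HodgeRepro2.T5GelfandUnimodular
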